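import Summits.ResolutionOfSingularities.ResolutionOfSingularities.Theorems.RadicialJungCleanModelsSufficeGameDefs

/-!
# Route `RadicialJung`, crux `CleanModelsSuffice`, line `Sketch`: the exceptionalisation GAME —
# pointwise data of a game state and the assembly of a state from pointwise data

Helper (definitions and their unfolding lemmas) for the registered stub `stub_exceptionalise` of the
skeleton of `Summit.ResolutionOfSingularities.ResolutionOfSingularities.Theses.RadicialJung.CleanModelsSuffice`
(stmt-ResolutionOfSingularities-15883). One ROUND of the game (`stub_gameRound`) constructs a `GameState` on a
blow-up POINT BY POINT (off the centre by transport, over the centre by the chart computation); to let the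
two cases be separate registered stubs, this file introduces

* `GameState.PointData p V₀ L V ψ E x` — the data and axioms of a game state AT ONE POINT `x` of the model
  `ψ : V → V₀` with boundary list `E` (verbatim the fields of `GameState`, specialised to `x`);
* the pointwise measures `PointData.ch/IsLab/oldCh/mOld/expOf/chargedAt/oldExp/Nval` (verbatim);
* `GameState.ofPointData E P` — the state assembled from pointwise data `P : ∀ x, PointData … E x`, with the
  unfolding lemmas `mOld_ofPointData`, `chargedAt_ofPointData`, `Nval_ofPointData`, `E_ofPointData`.
-/

noncomputable section

set_option linter.dupNamespace false -- mandated namespace of this single-conjunct summit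

open CategoryTheory AlgebraicGeometry TopologicalSpace IsLocalRing
open Literature.AlgebraicGeometry.Resolution Literature.AlgebraicGeometry.Motives

namespace Summit.ResolutionOfSingularities.ResolutionOfSingularities.Theorems.RadicialJung.CleanModelsSuffice

namespace GameState

/-- **The data and axioms of a game state at one point** `x` of the model `ψ : V → V₀`, for a fixed
boundary list `E`: a labelled regular system of parameters, exponents, unit, generator and radicand, with
the axioms of `GameState` specialised to `x`. [folklore] -/
structure PointData (p : ℕ) (V₀ : Scheme.{0}) [IsIntegral V₀] (L : Type) [Field L]
    [Algebra V₀.functionField L] (V : Scheme.{0}) [IsIntegral V] (ψ : V ⟶ V₀) [IsDominant ψ]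
    (E : List V.IdealSheafData) (x : V) where
  /-- `emb dim 𝒪_{V,x}` -/
  d : ℕ
  /-- a regular system of parameters -/
  u : Fin d → V.presheaf.stalk x
  /-- the exponents -/
  a : Fin d → ℕ
  /-- the unit factor -/
  w : V.presheaf.stalk x
  /-- the labels of the members of `E` through `x` -/
  lab : {D : V.IdealSheafData // D ∈ E ∧ x ∈ D.support} → Fin d
  /-- the generator -/
  y : L
  /-- the radicand -/
  g : V₀.functionField
  isRegular : IsRegularLocalRing (V.presheaf.stalk x)
  spanFinrank_eq : (maximalIdeal (V.presheaf.stalk x)).spanFinrank = d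
  span_u : Ideal.span (Set.range u) = maximalIdeal (V.presheaf.stalk x)
  a_spec : ∀ i, a i = 0 ∨ ¬ p ∣ a i
  isUnit_w : IsUnit w
  lab_injective : Function.Injective lab
  stalkIdeal_lab : ∀ D, stalkIdeal D.1 x = Ideal.span {u (lab D)}
  y_not_mem : y ∉ Set.range (algebraMap V₀.functionField L)
  y_pow : algebraMap V₀.functionField L g = y ^ p
  map_g : RatFn.functionFieldMap ψ g =
    algebraMap (V.presheaf.stalk x) V.functionField (w * ∏ i, u i ^ a i)
  reg : (∀ i, a i = 0) →
    (∀ z : V.presheaf.stalk x, w - z ^ p ∉ maximalIdeal (V.presheaf.stalk x)) ∨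
      (∃ z : V.presheaf.stalk x, w - z ^ p ∈ maximalIdeal (V.presheaf.stalk x) ∧
        w - z ^ p ∉ maximalIdeal (V.presheaf.stalk x) ^ 2 ⊔ Ideal.span (u '' Set.range lab))

namespace PointData

variable {p : ℕ} {V₀ : Scheme.{0}} [IsIntegral V₀] {L : Type} [Field L] [Algebra V₀.functionField L]
  {V : Scheme.{0}} [IsIntegral V] {ψ : V ⟶ V₀} [IsDominant ψ] {E : List V.IdealSheafData} {x : V}
  (P : PointData p V₀ L V ψ E x)

/-- The charged coordinates. [folklore] -/
def ch : Finset (Fin P.d) :=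
  Finset.univ.filter fun i => P.a i ≠ 0

/-- Boundary coordinates. [folklore] -/
def IsLab (i : Fin P.d) : Prop :=
  i ∈ Set.range P.lab

open Classical in
/-- Old charged coordinates. [folklore] -/
def oldCh : Finset (Fin P.d) :=
  P.ch.filter fun i => ¬ P.IsLab i

/-- Number of old charged components. [folklore] -/
def mOld : ℕ :=
  P.oldCh.card

open Classical in
/-- Exponent of a divisor. [folklore] -/
def expOf (D : V.IdealSheafData) : ℕ :=
  if h : D ∈ E ∧ x ∈ D.support then P.a (P.lab ⟨D, h⟩) else 0

/-- A divisor is charged at the point. [folklore] -/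
def chargedAt (D : V.IdealSheafData) : Prop :=
  P.expOf D ≠ 0

/-- Exponent of the old charged component. [folklore] -/
def oldExp : ℕ :=
  P.oldCh.sup P.a

/-- Resonance of a divisor (capped at `p`). [folklore] -/
def Nval (D : V.IdealSheafData) : ℕ :=
  sInf {n : ℕ | 1 ≤ n ∧ (p ∣ P.expOf D + n * P.oldExp ∨ n = p)}

end PointData

variable {p : ℕ} {V₀ : Scheme.{0}} [IsIntegral V₀] {L : Type} [Field L] [Algebra V₀.functionField L]
  {V : Scheme.{0}} [IsIntegral V] {ψ : V ⟶ V₀} [IsDominant ψ]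

/-- **The game state assembled from pointwise data.** [folklore] -/
def ofPointData (E : List V.IdealSheafData) (P : ∀ x : V, PointData p V₀ L V ψ E x) :
    GameState p V₀ L V ψ where
  E := E
  y x := (P x).y
  g x := (P x).g
  d x := (P x).d
  u x := (P x).u
  a x := (P x).a
  w x := (P x).w
  lab x := (P x).lab
  isRegular x := (P x).isRegular
  spanFinrank_eq x := (P x).spanFinrank_eq
  span_u x := (P x).span_u
  a_spec x := (P x).a_spec
  isUnit_w x := (P x).isUnit_w
  lab_injective x := (P x).lab_injective
  stalkIdeal_lab x := (P x).stalkIdeal_lab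
  y_not_mem x := (P x).y_not_mem
  y_pow x := (P x).y_pow
  map_g x := (P x).map_g
  reg x := (P x).reg

variable (E : List V.IdealSheafData) (P : ∀ x : V, PointData p V₀ L V ψ E x)

/-- Unfolding the boundary of the assembled state. [folklore] -/
@[simp] theorem E_ofPointData : (ofPointData E P).E = E := rfl

/-- Unfolding `mOld` of the assembled state. [folklore] -/
@[simp] theorem mOld_ofPointData (x : V) : (ofPointData E P).mOld x = (P x).mOld := rfl

/-- Unfolding `chargedAt` of the assembled state. [folklore] -/
@[simp] theorem chargedAt_ofPointData (D : V.IdealSheafData) (x : V) :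
    (ofPointData E P).chargedAt D x ↔ (P x).chargedAt D := Iff.rfl

/-- Unfolding `Nval` of the assembled state. [folklore] -/
@[simp] theorem Nval_ofPointData (x : V) (D : V.IdealSheafData) :
    (ofPointData E P).Nval x D = (P x).Nval D := rfl

end GameState

end Summit.ResolutionOfSingularities.ResolutionOfSingularities.Theorems.RadicialJung.CleanModelsSuffice

end
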